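import Summits.KontsevichZagierPeriods.KontsevichZagierPeriods.Theses.HurwitzMicroSectors
import Summits.KontsevichZagierPeriods.KontsevichZagierPeriods.Theorems.HurwitzMicroSectorsNormalFormPrinciplePiBoxTransfer

/-! TTRL-lite variant V2341 of stmt-KontsevichZagierPeriods-3869

Variant V2341 = `stub_boxRigidity` (BoxRigidity: two box-rational representations — domain the open
unit box, integrand `p/q` over `ℚ` — with equal values are KZ-equivalent) under the two-sided
small-case move `fix_nat:m'=2; bound_nat:m≤4` (right dimension frozen to `2`, left dimension `m ≤ 4`).
Verdict of the attempt seat: **open** — this file is the exact-strength certificate, not a proof of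
the variant. Freezing `m' = 2` next to `m ≤ 4` is idle: V2341 is EQUIVALENT to
**BoxVanishing in dimension `≤ 4`** — every box-rational representation on `(0,1)^m`, `m ≤ 4`, of
value `0` is a Kontsevich–Zagier relation (`stub_boxRigidity_var2341_iff_boxVanishingLe_four`: `⇒`
compare with the zero representation on the `2`-box; `⇐` pad both sides to the common box by unit
intervals, `pad_le`, subtract on the common box, `sub_same`, value `0` by soundness —
`boxRigidityLe_of_boxVanishingLe_four`, the rung `K = 4` of `boxRigidityLe_of_boxVanishingLe` of file
`…Variants2340`, restated here so that this certificate rests on the transfer file alone), equivalently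
to BoxRigidity with BOTH dimensions `≤ 4` (`stub_boxRigidity_var2341_iff_boxRigidityLe_four`). Hence
V2341 implies every jointly bounded or right-frozen sibling with dimensions `≤ 4`
(`boxRigidityLe_of_stub_boxRigidity_var2341`, `boxRigidityFix_of_stub_boxRigidity_var2341`), in
particular V2337/V2338 (`≤ 2` = BoxVanishing in dimension `2`: Catalan's `G` against `ℚ`, the
`π²`/`log 2` layer), V2339/V2340 (`≤ 3`: the case split `ζ(3) ∈ ℚ + ℚπ²` for `[1/(1−xyz)]` on `(0,1)³`
against `[a + b/(1−xy)]` on `(0,1)²`), all recorded open, and it is implied by V2343 (`≤ 5`); new at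
rung `4` are the weight-`4` box periods `ζ(4) = ∫_{(0,1)⁴} dx/(1−x₁x₂x₃x₄)` and
`ζ(2)² = ∫_{(0,1)⁴} dx/((1−x₁x₂)(1−x₃x₄))`, whose TRUE relation `2ζ(2)² = 5ζ(4)` the variant demands
as a chain of moves. `KontsevichZagierPeriods → V2341` (`stub_boxRigidity_var2341_of_statement`), so
a refutation of the variant would refute Conjecture 1 for the tree's calculus; no invariant of the
four moves beyond `eval` is known. The proved two-sided frontier stays `max j k ≤ 1` (Baker,
`boxRigidity_of_le_one`); no slice of V2341 with the frozen `m' = 2` is below it (already `m = 0`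
against `(0,1)²` is BoxVanishing in dimension `2`, `boxVanishing_two_of_stub_boxRigidity_var2341`).
Source: M. Kontsevich, D. Zagier, *Periods* (2001), §1.2 Conjecture 1 and rules 1)–3).
Pure proof file, no definitions. -/

-- `Summit.<Summit>.<Problem>` is the tree's mandated summit-side namespace (CONVENTIONS §2); for this
-- single-conjunct summit the two coincide, so the duplicate is deliberate.
set_option linter.dupNamespace false

noncomputable section

namespace Summit.KontsevichZagierPeriods.KontsevichZagierPeriods.Theorems

open MeasureTheory Set
open Literature.NumberTheory.Transcendental Literature.NumberTheory.Transcendental.KZ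
open Summit.KontsevichZagierPeriods.KontsevichZagierPeriods.Theses.HurwitzMicroSectors
open Summit.KontsevichZagierPeriods.HurwitzMicroSectors.NormalFormPrinciple.PiBox
open Summit.KontsevichZagierPeriods.HurwitzMicroSectors.NormalFormPrinciple.PiBox.stub_boxCombineAux
  (pad_le sub_same)

/-! ## V2341 ⇒ BoxVanishing in dimension `≤ 4` -/

/-- **V2341 ⇒ BoxVanishing(dim ≤ 4)**: compare a box-rational `N : IntegralRep m`, `m ≤ 4`, of value
`0` with the zero representation on the `2`-box (box-rational, value `0`, itself a relation).
[cite: KontsevichZagier2001, §1.2 Conjecture 1] -/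
theorem boxVanishingLe_four_of_stub_boxRigidity_var2341
    (h : ∀ (m : ℕ) (N : IntegralRep m) (N' : IntegralRep 2), m ≤ 4 → N.domain = {x | ∀ i, x i ∈ Set.Ioo (0:ℝ) 1} → N.IsRational → N'.domain = {x | ∀ i, x i ∈ Set.Ioo (0:ℝ) 1} → N'.IsRational → N.value = N'.value → Equivalent N N') :
    ∀ (m : ℕ) (N : IntegralRep m), m ≤ 4 → N.domain = {x | ∀ i, x i ∈ Set.Ioo (0:ℝ) 1} →
      N.IsRational → N.value = 0 → of N ∈ relations := by
  intro m N hm hNd hNr hv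
  obtain ⟨Z, hZd, hZi⟩ := exists_zeroRep (isSemialgebraic_box 2)
  have hZ : of Z ∈ relations := of_mem_relations_of_eqOn_zero Z (by simp [hZi, EqOn])
  have hZv : Z.value = 0 := by simp [IntegralRep.value, hZi]
  have hZr : Z.IsRational := ⟨0, 1, fun x _ => by simp, fun x _ => by simp [hZi]⟩
  have h' : of N - of Z ∈ relations := h m N Z hm hNd hNr hZd hZr (by rw [hv, hZv])
  have := relations.add_mem h' hZ
  rwa [sub_add_cancel] at this

/-- **V2341 ⇒ BoxVanishing in dimension `2`** (already the slice `m = 0` of the variant: the frozen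
side `(0,1)²` carries Conjecture 1 for all rational integrands over `ℚ` on the square — the first open
dimension). [cite: KontsevichZagier2001, §1.2 Conjecture 1] -/
theorem boxVanishing_two_of_stub_boxRigidity_var2341
    (h : ∀ (m : ℕ) (N : IntegralRep m) (N' : IntegralRep 2), m ≤ 4 → N.domain = {x | ∀ i, x i ∈ Set.Ioo (0:ℝ) 1} → N.IsRational → N'.domain = {x | ∀ i, x i ∈ Set.Ioo (0:ℝ) 1} → N'.IsRational → N.value = N'.value → Equivalent N N')
    (N : IntegralRep 2) (hNd : N.domain = {x | ∀ i, x i ∈ Set.Ioo (0:ℝ) 1}) (hNr : N.IsRational)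
    (hv : N.value = 0) : of N ∈ relations := by
  obtain ⟨Z, hZd, hZi⟩ := exists_zeroRep (isSemialgebraic_box 0)
  have hZ : of Z ∈ relations := of_mem_relations_of_eqOn_zero Z (by simp [hZi, EqOn])
  have hZv : Z.value = 0 := by simp [IntegralRep.value, hZi]
  have hZr : Z.IsRational := ⟨0, 1, fun x _ => by simp, fun x _ => by simp [hZi]⟩
  have h' : of Z - of N ∈ relations := h 0 Z N (Nat.zero_le 4) hZd hZr hNd hNr (by rw [hv, hZv])
  have := relations.sub_mem hZ h'
  rwa [sub_sub_cancel] at this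

/-! ## BoxVanishing in dimension `≤ 4` ⇒ BoxRigidity with jointly bounded dimensions -/

/-- **`BoxVanishing(dim ≤ 4) ⇒ BoxRigidity(m ≤ j, m' ≤ k)` whenever `max j k ≤ 4`**: pad both
representations by unit intervals to the common dimension `max m m' ≤ 4` (`pad_le`: one Newton–Leibniz
move and two null faces per step), subtract the integrands on the common box (`sub_same`, rule 1b));
the difference is box-rational of value `0` by soundness, hence a relation (the rung `K = 4` of
`boxRigidityLe_of_boxVanishingLe`, file `…Variants2340`, restated here to keep this certificate on the
transfer file alone). [cite: KontsevichZagier2001, §1.2 Conjecture 1] -/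
theorem boxRigidityLe_of_boxVanishingLe_four (j k : ℕ) (hjk : max j k ≤ 4)
    (hvan : ∀ (m : ℕ) (N : IntegralRep m), m ≤ 4 → N.domain = {x | ∀ i, x i ∈ Set.Ioo (0:ℝ) 1} →
      N.IsRational → N.value = 0 → of N ∈ relations) :
    ∀ (m m' : ℕ) (N : IntegralRep m) (N' : IntegralRep m'), m ≤ j → m' ≤ k →
      N.domain = {x | ∀ i, x i ∈ Set.Ioo (0:ℝ) 1} → N.IsRational →
      N'.domain = {x | ∀ i, x i ∈ Set.Ioo (0:ℝ) 1} → N'.IsRational →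
      N.value = N'.value → Equivalent N N' := by
  intro m m' N N' hm hm' hNd hNr hN'd hN'r hv
  obtain ⟨R₁, h₁d, h₁r, h₁⟩ := pad_le (le_max_left m m') N hNd hNr
  obtain ⟨R₂, h₂d, h₂r, h₂⟩ := pad_le (le_max_right m m') N' hN'd hN'r
  obtain ⟨M, hMd, hMr, hM⟩ := sub_same R₁ R₂ h₁d h₁r h₂d h₂r
  have hNM : of N - of N' - of M ∈ relations := by
    have e : of N - of N' - of M = (of N - of R₁) - (of N' - of R₂) + (of R₁ - of R₂ - of M) := by
      abel
    rw [e]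
    exact relations.add_mem (relations.sub_mem h₁ h₂) hM
  have hMv : M.value = 0 := by
    have e := relations_le_ker_eval_holds hNM
    rw [AddMonoidHom.mem_ker, map_sub, map_sub, eval_of, eval_of, eval_of, hv, sub_self,
      zero_sub, neg_eq_zero] at e
    exact e
  have := relations.add_mem hNM
    (hvan (max m m') M (le_trans (max_le_max hm hm') hjk) hMd hMr hMv)
  rwa [sub_add_cancel] at this

/-! ## BoxVanishing in dimension `≤ 4` ⇒ V2341 -/

/-- **BoxVanishing(dim ≤ 4) ⇒ V2341** (instance `j = 4, k = 2`, `m' = 2` of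
`boxRigidityLe_of_boxVanishingLe_four`). [cite: KontsevichZagier2001, §1.2 Conjecture 1] -/
theorem stub_boxRigidity_var2341_of_boxVanishingLe_four
    (hvan : ∀ (m : ℕ) (N : IntegralRep m), m ≤ 4 → N.domain = {x | ∀ i, x i ∈ Set.Ioo (0:ℝ) 1} →
      N.IsRational → N.value = 0 → of N ∈ relations) :
    ∀ (m : ℕ) (N : IntegralRep m) (N' : IntegralRep 2), m ≤ 4 → N.domain = {x | ∀ i, x i ∈ Set.Ioo (0:ℝ) 1} → N.IsRational → N'.domain = {x | ∀ i, x i ∈ Set.Ioo (0:ℝ) 1} → N'.IsRational → N.value = N'.value → Equivalent N N' :=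
  fun m N N' hm => boxRigidityLe_of_boxVanishingLe_four 4 2 (by norm_num) hvan m 2 N N' hm le_rfl

/-! ## The variant V2341 itself: exact strength -/

/-- **V2341 ⟺ BoxVanishing(dim ≤ 4)**: the variant is exactly "every rational function over `ℚ` on
`(0,1)^m`, `m ≤ 4`, absolutely integrable with integral `0`, is a KZ relation" — Conjecture 1 for all
box-rational periods of dimension `≤ 4`, open. [cite: KontsevichZagier2001, §1.2 Conjecture 1] -/
theorem stub_boxRigidity_var2341_iff_boxVanishingLe_four :
    (∀ (m : ℕ) (N : IntegralRep m) (N' : IntegralRep 2), m ≤ 4 → N.domain = {x | ∀ i, x i ∈ Set.Ioo (0:ℝ) 1} → N.IsRational → N'.domain = {x | ∀ i, x i ∈ Set.Ioo (0:ℝ) 1} → N'.IsRational → N.value = N'.value → Equivalent N N') ↔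
    (∀ (m : ℕ) (N : IntegralRep m), m ≤ 4 → N.domain = {x | ∀ i, x i ∈ Set.Ioo (0:ℝ) 1} →
      N.IsRational → N.value = 0 → of N ∈ relations) :=
  ⟨boxVanishingLe_four_of_stub_boxRigidity_var2341, stub_boxRigidity_var2341_of_boxVanishingLe_four⟩

/-- **V2341 ⟺ BoxRigidity with both dimensions `≤ 4`**: the frozen `m' = 2` is idle next to `m ≤ 4`
(the honest strength of the variant: Conjecture 1 for all pairs of rational integrands over `ℚ` on the
open unit boxes of dimension at most `4`). [cite: KontsevichZagier2001, §1.2 Conjecture 1] -/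
theorem stub_boxRigidity_var2341_iff_boxRigidityLe_four :
    (∀ (m : ℕ) (N : IntegralRep m) (N' : IntegralRep 2), m ≤ 4 → N.domain = {x | ∀ i, x i ∈ Set.Ioo (0:ℝ) 1} → N.IsRational → N'.domain = {x | ∀ i, x i ∈ Set.Ioo (0:ℝ) 1} → N'.IsRational → N.value = N'.value → Equivalent N N') ↔
    (∀ (m m' : ℕ) (N : IntegralRep m) (N' : IntegralRep m'), m ≤ 4 → m' ≤ 4 →
      N.domain = {x | ∀ i, x i ∈ Set.Ioo (0:ℝ) 1} → N.IsRational →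
      N'.domain = {x | ∀ i, x i ∈ Set.Ioo (0:ℝ) 1} → N'.IsRational →
      N.value = N'.value → Equivalent N N') :=
  ⟨fun h => boxRigidityLe_of_boxVanishingLe_four 4 4 (by norm_num)
      (boxVanishingLe_four_of_stub_boxRigidity_var2341 h),
    fun h m N N' hm => h m 2 N N' hm (by norm_num)⟩

/-- **V2341 dominates every jointly bounded sibling with `max j k ≤ 4`**: V2341 ⇒
`BoxRigidity(m ≤ j, m' ≤ k)` whenever `max j k ≤ 4` — in particular the recorded-open variants
V2338 (`j = k = 2`) and V2340 (`j = 3, k = 2`); so V2341 is open a fortiori.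
[cite: KontsevichZagier2001, §1.2 Conjecture 1] -/
theorem boxRigidityLe_of_stub_boxRigidity_var2341 (j k : ℕ) (hjk : max j k ≤ 4)
    (h : ∀ (m : ℕ) (N : IntegralRep m) (N' : IntegralRep 2), m ≤ 4 → N.domain = {x | ∀ i, x i ∈ Set.Ioo (0:ℝ) 1} → N.IsRational → N'.domain = {x | ∀ i, x i ∈ Set.Ioo (0:ℝ) 1} → N'.IsRational → N.value = N'.value → Equivalent N N') :
    ∀ (m m' : ℕ) (N : IntegralRep m) (N' : IntegralRep m'), m ≤ j → m' ≤ k →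
      N.domain = {x | ∀ i, x i ∈ Set.Ioo (0:ℝ) 1} → N.IsRational →
      N'.domain = {x | ∀ i, x i ∈ Set.Ioo (0:ℝ) 1} → N'.IsRational →
      N.value = N'.value → Equivalent N N' :=
  boxRigidityLe_of_boxVanishingLe_four j k hjk (boxVanishingLe_four_of_stub_boxRigidity_var2341 h)

/-- **Any frozen right dimension `m' ≤ 4` is at most the same variant**: V2341 ⇒ the sibling with the
right dimension frozen to any `m' ≤ 4` and `m ≤ j ≤ 4` (e.g. V2339: `m' = 2`, `m ≤ 3`; V2337:
`m' = 2`, `m ≤ 2`). [cite: KontsevichZagier2001, §1.2 Conjecture 1] -/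
theorem boxRigidityFix_of_stub_boxRigidity_var2341 (j m' : ℕ) (hj : j ≤ 4) (hm' : m' ≤ 4)
    (h : ∀ (m : ℕ) (N : IntegralRep m) (N' : IntegralRep 2), m ≤ 4 → N.domain = {x | ∀ i, x i ∈ Set.Ioo (0:ℝ) 1} → N.IsRational → N'.domain = {x | ∀ i, x i ∈ Set.Ioo (0:ℝ) 1} → N'.IsRational → N.value = N'.value → Equivalent N N') :
    ∀ (m : ℕ) (N : IntegralRep m) (N' : IntegralRep m'), m ≤ j →
      N.domain = {x | ∀ i, x i ∈ Set.Ioo (0:ℝ) 1} → N.IsRational →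
      N'.domain = {x | ∀ i, x i ∈ Set.Ioo (0:ℝ) 1} → N'.IsRational →
      N.value = N'.value → Equivalent N N' :=
  fun m N N' hm => boxRigidityLe_of_stub_boxRigidity_var2341 4 4 (by norm_num) h m m' N N'
    (hm.trans hj) hm'

/-- **Monotonicity in the rung**: BoxVanishing(dim ≤ 5) ⇒ V2341 (so the sibling V2343 = rung `5`
implies V2341 = rung `4`; the rungs increase with the bound). [cite: KontsevichZagier2001, §1.2 Conjecture 1] -/
theorem stub_boxRigidity_var2341_of_boxVanishingLe_five
    (hvan : ∀ (m : ℕ) (N : IntegralRep m), m ≤ 5 → N.domain = {x | ∀ i, x i ∈ Set.Ioo (0:ℝ) 1} →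
      N.IsRational → N.value = 0 → of N ∈ relations) :
    ∀ (m : ℕ) (N : IntegralRep m) (N' : IntegralRep 2), m ≤ 4 → N.domain = {x | ∀ i, x i ∈ Set.Ioo (0:ℝ) 1} → N.IsRational → N'.domain = {x | ∀ i, x i ∈ Set.Ioo (0:ℝ) 1} → N'.IsRational → N.value = N'.value → Equivalent N N' :=
  stub_boxRigidity_var2341_of_boxVanishingLe_four fun m N hm => hvan m N (hm.trans (by norm_num))

/-! ## The other side: the variant is implied by the Summit -/

/-- **The parent leaf ⇒ V2341** (specialisation `m' := 2`; the converse is not claimed — the parent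
is BoxVanishing in ALL dimensions). [cite: KontsevichZagier2001, §1.2 Conjecture 1] -/
theorem stub_boxRigidity_var2341_of_parent
    (h : ∀ (m m' : ℕ) (N : IntegralRep m) (N' : IntegralRep m'), N.domain = {x | ∀ i, x i ∈ Set.Ioo (0:ℝ) 1} → N.IsRational → N'.domain = {x | ∀ i, x i ∈ Set.Ioo (0:ℝ) 1} → N'.IsRational → N.value = N'.value → Equivalent N N') :
    ∀ (m : ℕ) (N : IntegralRep m) (N' : IntegralRep 2), m ≤ 4 → N.domain = {x | ∀ i, x i ∈ Set.Ioo (0:ℝ) 1} → N.IsRational → N'.domain = {x | ∀ i, x i ∈ Set.Ioo (0:ℝ) 1} → N'.IsRational → N.value = N'.value → Equivalent N N' :=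
  fun m N N' _ => h m 2 N N'

/-- **`KontsevichZagierPeriods ⇒ V2341`**: the variant is a special case of Conjecture 1 for the
tree's calculus (`leaves_of_statement`) — a refutation of the variant would refute the Summit.
[cite: KontsevichZagier2001, §1.2 Conjecture 1] -/
theorem stub_boxRigidity_var2341_of_statement (h : _root_.KontsevichZagierPeriods) :
    ∀ (m : ℕ) (N : IntegralRep m) (N' : IntegralRep 2), m ≤ 4 → N.domain = {x | ∀ i, x i ∈ Set.Ioo (0:ℝ) 1} → N.IsRational → N'.domain = {x | ∀ i, x i ∈ Set.Ioo (0:ℝ) 1} → N'.IsRational → N.value = N'.value → Equivalent N N' :=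
  stub_boxRigidity_var2341_of_parent (leaves_of_statement h).1

end Summit.KontsevichZagierPeriods.KontsevichZagierPeriods.Theorems
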